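import Summits.QuantumFields.BalabanUV.T4Continuum.Support.WeitzenbockBridge
import Summits.QuantumFields.BalabanUV.T4Continuum.Support.ComponentSwapShift
import Summits.QuantumFields.BalabanUV.T4Continuum.Support.ScalarLayerKronBridge

/-!
# T⁴ programme, spine node NE2 (U1a), row B2.w-laws — `PerturbationLaws` FOR THE WEITZENBÖCK CORRECTION (the lifted commutator /
# holonomy-defect blocks of the Hodge-form model), from the holonomy fields read as bounded two-level-consistent colour data

NE2 formalisation swarm `t4-ne2-formalise-*`, leaf prover 10 (gen 2), row **B2.w-laws** of `t4/formal/NE2/LEAVES.md` (tabled by OWNER RULING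
R16, CLAIMS.log 2026-08-20; parts of row B2.w already in the tree: `Support/LatticeWeitzenbock` p209345 — the exact identity
`½curlᴴcurl + divᴴdiv = rough + comm` —, `Support/WeitzenbockBridge` p210438 — `covLapC c (slotLift Rb) = lift (roughOp (D0 c Rb))` and
`hodge_sub_covLapC : lift (Hodge form) − covLapC = lift (commOp (D0 c Rb))` —, `Support/ShiftedZerothOrder` p208714 — the catalogue shape
`siteMul z · T` — and `Support/ComponentSwapShift` p210244 — the component-transposition carrier `Π_{νμ}`).
[Balaban1985BackgroundPropagators] (3.10) p.392 takes the Hessian of the Wilson action «generalizing the operator d*d» as the basic covariant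
operator; whether that is `½curlᴴcurl + Δ′` is the dictionary's question (B0, trigger c5) and is NOT asserted here.  THIS FILE gives the lifted
commutator operator `hodgeCorr L M Rb k := lift (commOp (D0 (L^k) (Rb k)))` the swarm's ONE TARGET SHAPE:
 * §1 0-form block algebra on `Tor × o`: the covariant unit shifts `Tcov Rb ν = siteMul (Rb ν)·(S_ν ⊗ 1)`, shifts moved through site
   multiplications (`kronShiftS_mul_siteMul`, `kronShiftSH_mul_siteMul`), `S_νS_μᴴ = S_μᴴS_ν`, and **`holBlock_eq`**:
   `T_νT_μᴴ − T_μᴴT_ν = siteMul (holField Rb ν μ)·((S_μᴴS_ν) ⊗ 1)` with the HOLONOMY-DEFECT FIELD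
   `holField Rb ν μ x = R_ν(x)·R_μ(x + e_ν − e_μ)ᴴ − R_μ(x − e_μ)ᴴ·R_ν(x − e_μ)` (for unitary `R` this is `R_μ(x−e_μ)ᴴ·(Hol_{μν}(x−e_μ) − 1)·R_ν(x−e_μ)`;
   `holField 1 = 0`);
 * §2 the reindex to the route's 1-form index `(Tor × Fin d) × o`: `lift (blk (siteMul z)) = siteMul (z ∘ fst)`, `lift (blk (Y ⊗ 1)) = (Y ⊗ 1) ⊗ 1`,
   **`lift_oneOp_eq_sum`**: `lift (oneOp B) = Σ_{ν,μ} (Π_{νμ} ⊗ 1)·lift (blk (B ν μ))`, hence **`lift_commOp_D0_eq_sum`**: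
   `lift (commOp (D0 c Rb)) = Σ_{ν,μ} siteMul ((c·c̄)•holField ν μ ∘ fst)·((Π_{νμ} ⊗ 1)·((S_μᴴS_ν) ⊗ 1))` (mixed shifts `S_μᴴS_ν ⊗ 1` = the owner's
   `ShiftedZerothOrder.Smix` carrier, component transposition = `ComponentSwapShift.cSwap`);
 * §3 along the tower: `holTower`, `hodgeCorr`, `hodgeCorr_eq_sum`, `hodgeForm_sub_covLapC_eq_hodgeCorr` (the B7-facing identity), and the END
   **`perturbationLaws_hodgeCorrection_of_shiftLaws`**: `(hz : ∀ ν μ, BoundedBackgroundM L M (holTower L M Rb ν μ) α β)` — the `d²` holonomy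
   fields `L^{2k}·holField` READ AS bounded, two-level-consistent colour data (NE3's currency via `NE2FromNE3`; displayed, c4-style) — and
   `(hS : ∀ μ ν, ShiftLaws … (k ↦ (S_μᴴS_ν) ⊗ 1) cm)` (the owner's `shiftLaws_mixed`, `cm = 2Cst`, `ShiftedZerothOrder` v1.1 — discharged BY NAME
   once it lands) ⟹ `PerturbationLaws (Δ_a⊗1) (hodgeCorr L M Rb) (J⊗1) (d²·αCst) (k ↦ d²·Cst(α·cm + βCst)·L^{−k})`, via
   `ComponentSwapShift.perturbationLaws_siteMul_swap_mul` and `KroneckerUnits.perturbationLaws_finsetSum`.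
NOT in this file: the B5-type FEED deriving `hz` from `RegularTransporters` (size α, lattice-Lipschitz β: `c²(Hol − 1) = c(Δ_μw_ν − Δ_νw_μ) + O(α²)`)
and B6 — a follow-up row if the owner wants it.

HONEST FRAMING (T4-DAG p. 1).  [folklore] bookkeeping + algebra OURS at MODEL LEVEL (transporters `Rb`, holonomy fields, shifts are DATA; no
transporter constructed); it does NOT assert that (3.10)'s Hessian is the Hodge form, nor the dictionary B0, nor identify `holField` with
Bałaban's plaquette variables beyond the algebra shown; finite torus, linear layer, operator norm; NOT [B9] (3.10)/(3.23)–(3.26) as printed; NE2 NOT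
PROVED; NOT infinite volume, NOT a mass gap, NOT Clay, NOT summit progress; spine 0/9 unchanged.  HONEST DEPENDENCY: continuum YM on T⁴ ⇐
BetaPertH ∧ nine spine estimates (0/9 proved); BetaPertH ⇐ (D1) ∧ (D4) ∧ CAP+tail; G-an2-4 gates asym, D1 and NE2/3/4.  ABSOLUTE RULE kept:
nothing printed is a hypothesis; no `def … : Prop` fact; no `sorry`.
-/

noncomputable section

open scoped BigOperators ComplexConjugate Matrix Matrix.Norms.L2Operator Kronecker

namespace Summit.QuantumFields.BalabanUV.T4Continuum.HodgeCorrectionLaws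

open Literature.MathematicalPhysics.QuantumFieldTheory.Balaban1983to89.B5Prop11Plancherel
open Literature.MathematicalPhysics.QuantumFieldTheory.Balaban1983to89.B5Action121 (shiftS shiftS_conjTranspose_apply)
open Literature.MathematicalPhysics.QuantumFieldTheory.Balaban1983to89.B5G183RateUnitTower (lev lev_neZero)
open Summit.QuantumFields.BalabanUV.T4Continuum
open Summit.QuantumFields.BalabanUV.T4Continuum.BalabanAveragedTowerUnit (idx cast_lev')
open Summit.QuantumFields.BalabanUV.T4Continuum.BackgroundResolventTower
open Summit.QuantumFields.BalabanUV.T4Continuum.KroneckerLift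
open Summit.QuantumFields.BalabanUV.T4Continuum.KroneckerUnits (perturbationLaws_finsetSum)
open Summit.QuantumFields.BalabanUV.T4Continuum.BlockMultiplication
open Summit.QuantumFields.BalabanUV.T4Continuum.ColourCovariantLaplacian (BoundedBackgroundM covLapC)
open Summit.QuantumFields.BalabanUV.T4Continuum.TransportedSiteAveraging (Dc Jc)
open Summit.QuantumFields.BalabanUV.T4Continuum.ShiftedZerothOrder (ShiftLaws)
open Summit.QuantumFields.BalabanUV.T4Continuum.ComponentSwapShift (swapT swapT_apply cSwap perturbationLaws_siteMul_swap_mul)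
open Summit.QuantumFields.BalabanUV.T4Continuum.LatticeWeitzenbock (oneOp curlOp divOp commOp commOp_affine)
open Summit.QuantumFields.BalabanUV.T4Continuum.WeitzenbockBridge (lift lift_apply lift_mul lift_smul lift_sum blk blk_apply blk_mul D0 slotLift
  hodge_sub_covLapC)
open Summit.QuantumFields.BalabanUV.T4Continuum.ScalarLayerKronBridge (shiftM_eq_kron)

variable {d : ℕ}

/-! ## §1 Block algebra on 0-forms ⊗ colour -/

section ZeroForms

variable (Nf : Fin d → ℕ) [hNf : ∀ μ, NeZero (Nf μ)] {o : Type*} [Fintype o] [DecidableEq o]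

/-- **`(S_ν ⊗ 1)·siteMul w = siteMul (w(· + e_ν))·(S_ν ⊗ 1)`** on 0-forms ⊗ colour. [folklore] -/
theorem kronShiftS_mul_siteMul (ν : Fin d) (w : Tor Nf → Matrix o o ℂ) :
    shiftS Nf ν ⊗ₖ (1 : Matrix o o ℂ) * siteMul w = siteMul (fun x => w (x + unitVec Nf ν)) * shiftS Nf ν ⊗ₖ (1 : Matrix o o ℂ) := by
  refine kron_mul_siteMul_eq fun i j hij => ?_
  have hj : j = i + unitVec Nf ν := by
    by_contra hne; exact hij (by simp [shiftS, hne])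
  subst hj; rfl

/-- **`(S_μᴴ ⊗ 1)·siteMul w = siteMul (w(· − e_μ))·(S_μᴴ ⊗ 1)`**. [folklore] -/
theorem kronShiftSH_mul_siteMul (μ : Fin d) (w : Tor Nf → Matrix o o ℂ) :
    (shiftS Nf μ)ᴴ ⊗ₖ (1 : Matrix o o ℂ) * siteMul w = siteMul (fun x => w (x - unitVec Nf μ)) * (shiftS Nf μ)ᴴ ⊗ₖ (1 : Matrix o o ℂ) := by
  refine kron_mul_siteMul_eq fun i j hij => ?_
  have hj : j = i - unitVec Nf μ := by
    by_contra hne; exact hij (by rw [shiftS_conjTranspose_apply, if_neg hne])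
  subst hj; rfl

/-- lattice translations commute: `S_ν·S_μᴴ = S_μᴴ·S_ν`. [folklore] -/
theorem shiftS_mul_conjTranspose_comm (ν μ : Fin d) : shiftS Nf ν * (shiftS Nf μ)ᴴ = (shiftS Nf μ)ᴴ * shiftS Nf ν := by
  ext x y
  have hL : (shiftS Nf ν * (shiftS Nf μ)ᴴ) x y = if y = x + unitVec Nf ν - unitVec Nf μ then 1 else 0 := by
    rw [Matrix.mul_apply, Finset.sum_eq_single (x + unitVec Nf ν)]
    · rw [shiftS_conjTranspose_apply]; simp [shiftS]
    · intro z _ hz; simp [shiftS, hz]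
    · intro h; exact absurd (Finset.mem_univ _) h
  have hR : ((shiftS Nf μ)ᴴ * shiftS Nf ν) x y = if y = x - unitVec Nf μ + unitVec Nf ν then 1 else 0 := by
    rw [Matrix.mul_apply, Finset.sum_eq_single (x - unitVec Nf μ)]
    · rw [shiftS_conjTranspose_apply]; simp [shiftS]
    · intro z _ hz; rw [shiftS_conjTranspose_apply, if_neg hz, zero_mul]
    · intro h; exact absurd (Finset.mem_univ _) h
  rw [hL, hR, sub_add_eq_add_sub]

/-- **THE COVARIANT UNIT SHIFT** on 0-forms ⊗ colour: `T_ν = siteMul (Rb ν)·(S_ν ⊗ 1)` (the operator inside `WeitzenbockBridge.D0 c Rb ν =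
c•(T_ν − 1)`). [cite: Balaban1985BackgroundPropagators, (3.3) p.390 (shape)] [folklore] -/
def Tcov (Rb : Fin d → Tor Nf → Matrix o o ℂ) (ν : Fin d) : Matrix (Tor Nf × o) (Tor Nf × o) ℂ :=
  siteMul (Rb ν) * shiftS Nf ν ⊗ₖ (1 : Matrix o o ℂ)

/-- `D0 c Rb ν = c•(T_ν − 1)` (definitional). [folklore] -/
theorem D0_eq (c : ℂ) (Rb : Fin d → Tor Nf → Matrix o o ℂ) : D0 Nf c Rb = fun ν => c • (Tcov Nf Rb ν - 1) := rfl

/-- **THE HOLONOMY-DEFECT FIELD** of the pair `(ν, μ)`: `holField Rb ν μ x = R_ν(x)·R_μ(x + e_ν − e_μ)ᴴ − R_μ(x − e_μ)ᴴ·R_ν(x − e_μ)`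
(for unitary transporters `= R_μ(x−e_μ)ᴴ·(Hol_{μν}(x−e_μ) − 1)·R_ν(x−e_μ)`; DATA here). [folklore] -/
def holField (Rb : Fin d → Tor Nf → Matrix o o ℂ) (ν μ : Fin d) (x : Tor Nf) : Matrix o o ℂ :=
  Rb ν x * (Rb μ (x + unitVec Nf ν - unitVec Nf μ))ᴴ - (Rb μ (x - unitVec Nf μ))ᴴ * Rb ν (x - unitVec Nf μ)

omit hNf in
/-- at the trivial background the holonomy-defect field VANISHES. [folklore] -/
theorem holField_one (ν μ : Fin d) : holField Nf (fun _ _ => (1 : Matrix o o ℂ)) ν μ = fun _ => 0 := by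
  funext x; simp [holField]

/-- `T_ν·T_μᴴ = siteMul (R_ν·R_μ(· + e_ν − e_μ)ᴴ)·((S_νS_μᴴ) ⊗ 1)`. [folklore] -/
theorem Tcov_mul_conjTranspose (Rb : Fin d → Tor Nf → Matrix o o ℂ) (ν μ : Fin d) :
    Tcov Nf Rb ν * (Tcov Nf Rb μ)ᴴ
      = siteMul (fun x => Rb ν x * (Rb μ (x + unitVec Nf ν - unitVec Nf μ))ᴴ) * (shiftS Nf ν * (shiftS Nf μ)ᴴ) ⊗ₖ (1 : Matrix o o ℂ) := by
  have h1 := kronShiftSH_mul_siteMul Nf μ (fun x => (Rb μ x)ᴴ)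
  have h2 := kronShiftS_mul_siteMul Nf ν (fun x => (Rb μ (x - unitVec Nf μ))ᴴ)
  calc Tcov Nf Rb ν * (Tcov Nf Rb μ)ᴴ
      = siteMul (Rb ν) * shiftS Nf ν ⊗ₖ (1 : Matrix o o ℂ) * ((shiftS Nf μ)ᴴ ⊗ₖ (1 : Matrix o o ℂ) * siteMul fun x => (Rb μ x)ᴴ) := by
        rw [Tcov, Tcov, Matrix.conjTranspose_mul, kron_conjTranspose, siteMul_conjTranspose]
    _ = siteMul (Rb ν) * (shiftS Nf ν ⊗ₖ (1 : Matrix o o ℂ) * siteMul fun x => (Rb μ (x - unitVec Nf μ))ᴴ)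
          * (shiftS Nf μ)ᴴ ⊗ₖ (1 : Matrix o o ℂ) := by
        rw [h1]; simp only [Matrix.mul_assoc]
    _ = siteMul (Rb ν) * siteMul (fun x => (Rb μ (x + unitVec Nf ν - unitVec Nf μ))ᴴ) * shiftS Nf ν ⊗ₖ (1 : Matrix o o ℂ)
          * (shiftS Nf μ)ᴴ ⊗ₖ (1 : Matrix o o ℂ) := by
        rw [h2]; simp only [Matrix.mul_assoc]
    _ = _ := by rw [siteMul_mul, Matrix.mul_assoc, ← kron_mul]

/-- `T_μᴴ·T_ν = siteMul ((R_μᴴR_ν)(· − e_μ))·((S_μᴴS_ν) ⊗ 1)`. [folklore] -/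
theorem Tcov_conjTranspose_mul (Rb : Fin d → Tor Nf → Matrix o o ℂ) (ν μ : Fin d) :
    (Tcov Nf Rb μ)ᴴ * Tcov Nf Rb ν
      = siteMul (fun x => (Rb μ (x - unitVec Nf μ))ᴴ * Rb ν (x - unitVec Nf μ)) * ((shiftS Nf μ)ᴴ * shiftS Nf ν) ⊗ₖ (1 : Matrix o o ℂ) := by
  have h1 := kronShiftSH_mul_siteMul Nf μ (fun x => (Rb μ x)ᴴ * Rb ν x)
  calc (Tcov Nf Rb μ)ᴴ * Tcov Nf Rb ν
      = (shiftS Nf μ)ᴴ ⊗ₖ (1 : Matrix o o ℂ) * ((siteMul fun x => (Rb μ x)ᴴ) * siteMul (Rb ν)) * shiftS Nf ν ⊗ₖ (1 : Matrix o o ℂ) := by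
        rw [Tcov, Tcov, Matrix.conjTranspose_mul, kron_conjTranspose, siteMul_conjTranspose]; simp only [Matrix.mul_assoc]
    _ = (shiftS Nf μ)ᴴ ⊗ₖ (1 : Matrix o o ℂ) * (siteMul fun x => (Rb μ x)ᴴ * Rb ν x) * shiftS Nf ν ⊗ₖ (1 : Matrix o o ℂ) := by
        rw [siteMul_mul]
    _ = siteMul (fun x => (Rb μ (x - unitVec Nf μ))ᴴ * Rb ν (x - unitVec Nf μ)) * (shiftS Nf μ)ᴴ ⊗ₖ (1 : Matrix o o ℂ)
          * shiftS Nf ν ⊗ₖ (1 : Matrix o o ℂ) := by rw [h1]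
    _ = _ := by rw [Matrix.mul_assoc, ← kron_mul]

/-- **THE HOLONOMY BLOCK**: `T_νT_μᴴ − T_μᴴT_ν = siteMul (holField Rb ν μ)·((S_μᴴS_ν) ⊗ 1)` — a colour field times the mixed two-step
shift. [folklore] -/
theorem holBlock_eq (Rb : Fin d → Tor Nf → Matrix o o ℂ) (ν μ : Fin d) :
    Tcov Nf Rb ν * (Tcov Nf Rb μ)ᴴ - (Tcov Nf Rb μ)ᴴ * Tcov Nf Rb ν
      = siteMul (holField Nf Rb ν μ) * ((shiftS Nf μ)ᴴ * shiftS Nf ν) ⊗ₖ (1 : Matrix o o ℂ) := by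
  rw [Tcov_mul_conjTranspose, Tcov_conjTranspose_mul, shiftS_mul_conjTranspose_comm, ← Matrix.sub_mul, ← siteMul_sub]
  rfl

/-! ## §2 The reindex to the route's 1-form index `(Tor × Fin d) × o` -/

omit hNf [Fintype o] [DecidableEq o] in
/-- a block-diagonal site multiplication lifts to the site multiplication by the slot-independent field. [folklore] -/
theorem lift_blk_siteMul (z : Tor Nf → Matrix o o ℂ) :
    lift Nf (blk (siteMul z)) = siteMul fun i : Tor Nf × Fin d => z i.1 := by
  ext ⟨⟨x, κ⟩, a⟩ ⟨⟨y, κ'⟩, b⟩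
  rw [lift_apply, blk_apply, siteMul_apply, siteMul_apply]
  simp only [Prod.mk.injEq]
  by_cases hκ : κ = κ' <;> by_cases hx : x = y <;> simp [hκ, hx]

omit hNf [Fintype o] in
/-- a block-diagonal lifted 0-form operator lifts to the twice-lifted operator. [folklore] -/
theorem lift_blk_kron (Y : Matrix (Tor Nf) (Tor Nf) ℂ) :
    lift Nf (blk (Y ⊗ₖ (1 : Matrix o o ℂ))) = (Y ⊗ₖ (1 : Matrix (Fin d) (Fin d) ℂ)) ⊗ₖ (1 : Matrix o o ℂ) := by
  ext ⟨⟨x, κ⟩, a⟩ ⟨⟨y, κ'⟩, b⟩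
  rw [lift_apply, blk_apply]
  simp only [Matrix.kroneckerMap_apply, Matrix.one_apply]
  by_cases hκ : κ = κ' <;> simp [hκ]

/-- rows of `(Π_{νμ} ⊗ 1)·X`: row `((x, κ), a)` is row `((x, μ), a)` of `X` if `κ = ν`, else zero. [folklore] -/
theorem swapKron_mul_apply {γ : Type*} (ν μ : Fin d) (X : Matrix ((Tor Nf × Fin d) × o) γ ℂ) (x : Tor Nf) (κ : Fin d) (a : o) (j : γ) :
    (swapT Nf ν μ ⊗ₖ (1 : Matrix o o ℂ) * X) ((x, κ), a) j = if κ = ν then X ((x, μ), a) j else 0 := by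
  rw [Matrix.mul_apply, Finset.sum_eq_single ((x, μ), a)]
  · rw [Matrix.kroneckerMap_apply, swapT_apply, Matrix.one_apply_eq]
    by_cases hκ : κ = ν <;> simp [hκ]
  · rintro ⟨⟨x', κ'⟩, a'⟩ _ hne
    rw [Matrix.kroneckerMap_apply, swapT_apply, Matrix.one_apply]
    by_cases h : κ = ν ∧ ((x', κ') : Tor Nf × Fin d) = (x, μ)
    · by_cases ha : a = a'
      · exact absurd (by rw [h.2, ha]) hne
      · rw [if_neg ha, mul_zero, zero_mul]
    · rw [if_neg h, zero_mul, zero_mul]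
  · intro h; exact absurd (Finset.mem_univ _) h

/-- **THE BLOCK DECOMPOSITION**: `lift (oneOp B) = Σ_{ν,μ} (Π_{νμ} ⊗ 1)·lift (blk (B ν μ))` — every block of a 1-form operator is a
component transposition times a block-diagonal operator. [folklore] -/
theorem lift_oneOp_eq_sum (B : Fin d → Fin d → Matrix (Tor Nf × o) (Tor Nf × o) ℂ) :
    lift Nf (oneOp B) = ∑ ν, ∑ μ, swapT Nf ν μ ⊗ₖ (1 : Matrix o o ℂ) * lift Nf (blk (B ν μ)) := by
  ext ⟨⟨x, κ⟩, a⟩ ⟨⟨y, κ'⟩, b⟩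
  rw [lift_apply, Matrix.sum_apply, Finset.sum_eq_single κ]
  · rw [Matrix.sum_apply, Finset.sum_eq_single κ']
    · rw [swapKron_mul_apply, if_pos rfl, lift_apply, blk_apply, if_pos rfl]
      simp only [oneOp, Matrix.of_apply]
    · intro μ _ hμ; rw [swapKron_mul_apply, if_pos rfl, lift_apply, blk_apply, if_neg hμ]
    · intro h; exact absurd (Finset.mem_univ _) h
  · intro ν _ hν
    rw [Matrix.sum_apply]
    exact Finset.sum_eq_zero fun μ _ => by rw [swapKron_mul_apply, if_neg (Ne.symm hν)]
  · intro h; exact absurd (Finset.mem_univ _) h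

omit [Fintype o] in
/-- the mixed 0-form shifts, lifted twice, are the mixed 1-form shifts lifted once. [folklore] -/
theorem lift_blk_mixedShift (μ ν : Fin d) :
    lift Nf (blk (((shiftS Nf μ)ᴴ * shiftS Nf ν) ⊗ₖ (1 : Matrix o o ℂ)))
      = ((shiftM Nf μ)ᴴ * shiftM Nf ν) ⊗ₖ (1 : Matrix o o ℂ) := by
  rw [lift_blk_kron, shiftM_eq_kron, shiftM_eq_kron, kron_conjTranspose, ← kron_mul]

/-- `Π_{νμ} ⊗ 1` commutes with a slot-independent site multiplication. [folklore] -/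
theorem swapKron_mul_siteMul_slotIndep (ν μ : Fin d) (z : Tor Nf → Matrix o o ℂ) :
    swapT Nf ν μ ⊗ₖ (1 : Matrix o o ℂ) * siteMul (fun i : Tor Nf × Fin d => z i.1)
      = siteMul (fun i : Tor Nf × Fin d => z i.1) * swapT Nf ν μ ⊗ₖ (1 : Matrix o o ℂ) := by
  refine kron_mul_siteMul_eq fun i j hij => ?_
  rw [swapT_apply] at hij
  by_cases h : i.2 = ν ∧ j = (i.1, μ)
  · rw [h.2]
  · exact absurd (if_neg h) hij

/-- **THE LIFTED COMMUTATOR OPERATOR AS A SUM OF CATALOGUE TERMS**: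
`lift (commOp (D0 c Rb)) = Σ_{ν,μ} siteMul ((c·c̄)•holField ν μ ∘ fst)·((Π_{νμ} ⊗ 1)·((S_μᴴS_ν) ⊗ 1))`. [folklore] -/
theorem lift_commOp_D0_eq_sum (c : ℂ) (Rb : Fin d → Tor Nf → Matrix o o ℂ) :
    lift Nf (commOp (D0 Nf c Rb))
      = ∑ ν, ∑ μ, siteMul (fun i : Tor Nf × Fin d => (c * star c) • holField Nf Rb ν μ i.1)
          * (swapT Nf ν μ ⊗ₖ (1 : Matrix o o ℂ) * ((shiftM Nf μ)ᴴ * shiftM Nf ν) ⊗ₖ (1 : Matrix o o ℂ)) := by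
  rw [D0_eq, commOp_affine, lift_smul]
  have hblk : (oneOp fun ν μ => Tcov Nf Rb ν * (Tcov Nf Rb μ)ᴴ - (Tcov Nf Rb μ)ᴴ * Tcov Nf Rb ν)
      = oneOp fun ν μ => siteMul (holField Nf Rb ν μ) * ((shiftS Nf μ)ᴴ * shiftS Nf ν) ⊗ₖ (1 : Matrix o o ℂ) := by
    congr 1; funext ν μ; exact holBlock_eq Nf Rb ν μ
  rw [hblk, lift_oneOp_eq_sum, Finset.smul_sum]
  refine Finset.sum_congr rfl fun ν _ => ?_
  rw [Finset.smul_sum]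
  refine Finset.sum_congr rfl fun μ _ => ?_
  rw [blk_mul, lift_mul, lift_blk_siteMul, lift_blk_mixedShift, ← Matrix.mul_assoc, swapKron_mul_siteMul_slotIndep, Matrix.mul_assoc,
    ← Matrix.smul_mul, ← siteMul_smul]

end ZeroForms

/-! ## §3 Along the tower: the Weitzenböck correction and its `PerturbationLaws` -/

section Tower

variable (L : ℕ) [NeZero L] (M : Fin d → ℕ) [hM : ∀ μ, NeZero (M μ)] (a : ℝ) (ha : 0 < a) {o : Type*} [Fintype o] [DecidableEq o]

/-- **THE HOLONOMY TOWER** (slot-independent colour fields on the 1-form index): `holTower Rb ν μ k (x, κ) = L^{2k}·holField (Rb k) ν μ x`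
(`c_k·c̄_k = L^{2k}`, `c_k = L^k` the lattice factor of level `k`). [folklore] -/
def holTower (Rb : (k : ℕ) → Fin d → Tor (fine (lev L k) M) → Matrix o o ℂ) (ν μ : Fin d) (k : ℕ) (i : idx L M k) : Matrix o o ℂ :=
  ((((lev L k : ℕ) : ℂ)) * star (((lev L k : ℕ) : ℂ))) • holField (fine (lev L k) M) (Rb k) ν μ i.1

/-- **THE WEITZENBÖCK CORRECTION** of level `k`: the lifted commutator operator `lift (commOp (D0 (L^k) (Rb k)))` on the route's colour-lifted
1-forms (`= lift (Hodge form) − covLapC`, `WeitzenbockBridge.hodge_sub_covLapC`). [folklore] -/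
def hodgeCorr (Rb : (k : ℕ) → Fin d → Tor (fine (lev L k) M) → Matrix o o ℂ) (k : ℕ) : Matrix (idx L M k × o) (idx L M k × o) ℂ :=
  lift (fine (lev L k) M) (commOp (D0 (fine (lev L k) M) (((lev L k : ℕ) : ℂ)) (Rb k)))

/-- the B7-facing identity: at every level the Hodge-form model operator minus row B2's `covLapC` IS `hodgeCorr`. [folklore] -/
theorem hodgeForm_sub_covLapC_eq_hodgeCorr (Rb : (k : ℕ) → Fin d → Tor (fine (lev L k) M) → Matrix o o ℂ) (k : ℕ) :
    lift (fine (lev L k) M)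
        ((2 : ℂ)⁻¹ • ((curlOp (D0 (fine (lev L k) M) (((lev L k : ℕ) : ℂ)) (Rb k)))ᴴ * curlOp (D0 (fine (lev L k) M) (((lev L k : ℕ) : ℂ)) (Rb k)))
          + (divOp (D0 (fine (lev L k) M) (((lev L k : ℕ) : ℂ)) (Rb k)))ᴴ * divOp (D0 (fine (lev L k) M) (((lev L k : ℕ) : ℂ)) (Rb k)))
      - covLapC (fine (lev L k) M) (((lev L k : ℕ) : ℂ)) (slotLift (fine (lev L k) M) (Rb k)) = hodgeCorr L M Rb k :=
  hodge_sub_covLapC (fine (lev L k) M) _ (Rb k)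

/-- **`hodgeCorr` AS A SUM OF `d²` CATALOGUE TERMS** `siteMul (holTower ν μ k)·(cSwap ν μ k·((S_μᴴS_ν) ⊗ 1))`. [folklore] -/
theorem hodgeCorr_eq_sum (Rb : (k : ℕ) → Fin d → Tor (fine (lev L k) M) → Matrix o o ℂ) (k : ℕ) :
    hodgeCorr L M Rb k = ∑ ν, ∑ μ, siteMul (holTower L M Rb ν μ k)
      * (cSwap L M (o := o) ν μ k * ((shiftM (fine (lev L k) M) μ)ᴴ * shiftM (fine (lev L k) M) ν) ⊗ₖ (1 : Matrix o o ℂ)) :=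
  lift_commOp_D0_eq_sum (fine (lev L k) M) _ (Rb k)

/-- **`PerturbationLaws` FOR THE WEITZENBÖCK CORRECTION** (row B2.w-laws' END, generic in the mixed-shift law): if the `d²` holonomy towers
are bounded two-level-consistent colour data (`hz`; NE3's currency) and the mixed two-step shifts obey `ShiftLaws` with constant `cm` (`hS`; the
owner's `ShiftedZerothOrder.shiftLaws_mixed` gives `cm = 2Cst`), then
`PerturbationLaws (Δ_a⊗1) (hodgeCorr Rb) (J⊗1) (d²·αCst) (k ↦ d²·Cst(α·cm + βCst)·L^{−k})`. [folklore] -/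
theorem perturbationLaws_hodgeCorrection_of_shiftLaws {Rb : (k : ℕ) → Fin d → Tor (fine (lev L k) M) → Matrix o o ℂ} {α β cm : ℝ}
    (hz : ∀ ν μ, BoundedBackgroundM L M (holTower L M Rb ν μ) α β)
    (hS : ∀ μ ν, ShiftLaws L M a ha (fun k => ((shiftM (fine (lev L k) M) μ)ᴴ * shiftM (fine (lev L k) M) ν) ⊗ₖ (1 : Matrix o o ℂ)) cm) :
    PerturbationLaws (Dc L M a ha) (hodgeCorr L M Rb) (Jc L M)
      ((d : ℝ) ^ 2 * (α * Cst d a)) (fun k => (d : ℝ) ^ 2 * (Cst d a * (α * cm + β * Cst d a)) * ((L : ℝ)⁻¹) ^ k) := by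
  have e : hodgeCorr L M Rb = fun k => ∑ ν ∈ (Finset.univ : Finset (Fin d)), ∑ μ ∈ (Finset.univ : Finset (Fin d)),
      siteMul (holTower L M Rb ν μ k)
        * (cSwap L M (o := o) ν μ k * ((shiftM (fine (lev L k) M) μ)ᴴ * shiftM (fine (lev L k) M) ν) ⊗ₖ (1 : Matrix o o ℂ)) :=
    funext fun k => hodgeCorr_eq_sum L M Rb k
  rw [e]
  have h := perturbationLaws_finsetSum (Finset.univ : Finset (Fin d)) (D := Dc L M a ha) (J := Jc L M (o := o))
    (P := fun ν k => ∑ μ ∈ (Finset.univ : Finset (Fin d)), siteMul (holTower L M Rb ν μ k)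
      * (cSwap L M (o := o) ν μ k * ((shiftM (fine (lev L k) M) μ)ᴴ * shiftM (fine (lev L k) M) ν) ⊗ₖ (1 : Matrix o o ℂ)))
    (κ := fun _ => ∑ _μ ∈ (Finset.univ : Finset (Fin d)), α * Cst d a)
    (e := fun _ k => ∑ _μ ∈ (Finset.univ : Finset (Fin d)), Cst d a * (α * cm + β * Cst d a) * ((L : ℝ)⁻¹) ^ k)
    fun ν _ => perturbationLaws_finsetSum (Finset.univ : Finset (Fin d))
      fun μ _ => perturbationLaws_siteMul_swap_mul L M a ha (hz ν μ) ν μ (hS μ ν)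
  refine PerturbationAlgebra.perturbationLaws_mono h (le_of_eq ?_) fun k => le_of_eq ?_
  · simp only [Finset.sum_const, Finset.card_univ, Fintype.card_fin]; ring
  · simp only [Finset.sum_const, Finset.card_univ, Fintype.card_fin]; ring

/-- at the trivial background the correction VANISHES (`holField 1 = 0`), so `Δ_a⊗1 + hodgeCorr 1 = Δ_a⊗1` BY CONSTRUCTION (c5). [folklore] -/
theorem hodgeCorr_trivial (k : ℕ) : hodgeCorr L M (fun k _ (_ : Tor (fine (lev L k) M)) => (1 : Matrix o o ℂ)) k = 0 := by
  rw [hodgeCorr_eq_sum]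
  refine Finset.sum_eq_zero fun ν _ => Finset.sum_eq_zero fun μ _ => ?_
  have h0 : holTower L M (fun k _ (_ : Tor (fine (lev L k) M)) => (1 : Matrix o o ℂ)) ν μ k = fun _ => 0 := by
    funext i; simp [holTower, holField]
  rw [h0]
  have hs : siteMul (fun _ : idx L M k => (0 : Matrix o o ℂ)) = 0 := by
    have h := siteMul_smul (0 : ℂ) (fun _ : idx L M k => (1 : Matrix o o ℂ))
    simp only [zero_smul] at h
    exact h
  rw [hs, Matrix.zero_mul]

end Tower

/-! ## §4 (v1.1 append) The mixed-shift law DISCHARGED by the owner's `shiftLaws_mixed` (`ShiftedZerothOrder` v1.1, p209079/p209934) -/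

section Discharged

variable (L : ℕ) [NeZero L] (M : Fin d → ℕ) [hM : ∀ μ, NeZero (M μ)] (a : ℝ) (ha : 0 < a) {o : Type*} [Fintype o] [DecidableEq o]

/-- **`perturbationLaws_hodgeCorrection`** (row B2.w-laws' END in OWNER RULING R16's form): the `d²` holonomy towers read as bounded
two-level-consistent colour data (`hz`; NE3's currency) ⟹ `PerturbationLaws (Δ_a⊗1) (hodgeCorr Rb) (J⊗1) (d²·αCst) (k ↦ d²·Cst(α·2Cst + βCst)·L^{−k})`
— the mixed-shift `ShiftLaws` binder `hS` of `perturbationLaws_hodgeCorrection_of_shiftLaws` DISCHARGED BY NAME by the owner's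
`ShiftedZerothOrder.shiftLaws_mixed` (`Smix μ ν k = (S_μᴴS_ν) ⊗ 1`, `cm = 2Cst`).  NOT NE2; model level; no B0. [folklore] -/
theorem perturbationLaws_hodgeCorrection {Rb : (k : ℕ) → Fin d → Tor (fine (lev L k) M) → Matrix o o ℂ} {α β : ℝ}
    (hz : ∀ ν μ, BoundedBackgroundM L M (holTower L M Rb ν μ) α β) :
    PerturbationLaws (Dc L M a ha) (hodgeCorr L M Rb) (Jc L M)
      ((d : ℝ) ^ 2 * (α * Cst d a)) (fun k => (d : ℝ) ^ 2 * (Cst d a * (α * (2 * Cst d a) + β * Cst d a)) * ((L : ℝ)⁻¹) ^ k) :=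
  perturbationLaws_hodgeCorrection_of_shiftLaws L M a ha hz fun μ ν => ShiftedZerothOrder.shiftLaws_mixed L M a ha (o := o) μ ν

end Discharged

end Summit.QuantumFields.BalabanUV.T4Continuum.HodgeCorrectionLaws

end
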